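import Summits.NavierStokesRegularity.TurbBounds.ShearDensity
import Summits.NavierStokesRegularity.TurbBounds.LegendreCoeffs
import Summits.NavierStokesRegularity.TurbBounds.Certs.S50.CutoffFree
import HarnessLib

/-!
# Row R2-50 (FW16 2-D stress-driven shear layer, Γx = 2, Gr = 50) from TWO named hypotheses: the cited reduction `FW16Reduction`
# and the per-mode polynomial positivity `PolyPositivityS50` of the certified modes — cutoff, cover, relaxation, density, profileS50
# arithmetic kernel-checked
(cell `pub-turb` / `turb-bounds`, shear lane; v2 staging, written by pub-turb-shear gen 7, 2026-08-22. CERTIFIED.md row R2-50, container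
`T7-fw16-Gx2-Gr50-P4-N12-j111081` (rbcert.json sha256 9bdcefff37d2376c…): `C_ε ≤ 0.020000000002` at `Gr = 50`, `Γx = 2`; scalar lines in the tree
as `Certs.S50.Scalars` (p-ids in LEAN-MAP §0), blocks `Certs.S50.B001/B002`, evaluator `Certs.S50.EvalBlock1/2`, `CutoffFree`, `TailSlack`.)

HONEST FRAMING: rigorous bounds for the stated PDE and boundary conditions; no claim about physical turbulence beyond the bound.
WHAT IS KERNEL-CHECKED HERE: with `φ′ := Σ_{p ≤ 4} φ̂_p P_p` the row's literal profile derivative (`profileS50`; `φ̂ = Certs.S50.Scalars.phi`):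
`profileS50_eval_one` (`φ′(1) = Gr/2`, the stress boundary condition, from `Scalars.sum_phi`), `profileS50_abs_le` (`|φ′| ≤ ‖φ̂‖₁ = T` on `[−1, 1]`,
from `|P_p| ≤ 1`), `boundValue_profileS50` (`2∫φ′ − (2/Gr)∫φ′² = U(φ̂) = Scalars.U` by finite Parseval), and
`fw16Positivity_of_polyPositivity`: IF the relaxed forms of the two certified modes are `≥ 0` on admissible POLYNOMIAL pairs (`PolyPositivityS50`)
THEN FW16's spectral constraint holds for EVERY mode `m ≥ 1` on the admissible `C²` class (`ShearDensity.shearForm_nonneg_of_poly` →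
`ShearForm.fw16Form_nonneg_of_shearForm_cell` → `ShearForm.fw16Positivity_of_cover` with the landed cutoff line `Certs.S50.Scalars.cutoff`).
CONSEQUENCES: `surfaceVelocity_bound` — for every `ū` obeying `FW16Reduction 2 50 ū` (the cited reduction; docstring in `ShearForm`):
`PolyPositivityS50 → 49.999999998 ≤ U ≤ ū`, and `ceps_bound` : `C_ε = Gr/ū² ≤ Scalars.Ceps ≤ 0.020000000002`.
THE SECOND HYPOTHESIS `PolyPositivityS50` is exactly what the staged algebraic chain discharges (`Certs.S50.ModeForm.M1/M2.modeForm_nonneg` +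
`ShearBridgeNorms.norms_split` + the cross-term split on cert's Legendre triple products, v2 items V2-BRIDGE / V2-TAIL); it is stated here
as a `Prop` so that this file lands independently of them, exactly as `Results/P2R0.lean` first took `TailLemma` as a hypothesis.
NOT CLAIMED: any formalisation of the Navier–Stokes reduction (`FW16Reduction` stays a hypothesis, as in the paper's §4 / A.8).
-/

set_option linter.style.longLine false

noncomputable section

namespace Summit.NavierStokesRegularity.TurbBounds.Results.S50

open Polynomial intervalIntegral MeasureTheory Set Finset
open Literature.Analysis.SpecialFunctions (legendre eval_one_legendre natDegree_legendre abs_eval_legendre_le_one legendre_zero)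
open Summit.NavierStokesRegularity.TurbBounds.ShearForm
open Summit.NavierStokesRegularity.TurbBounds.ShearDensity (shearForm_nonneg_of_poly)
open Summit.NavierStokesRegularity.TurbBounds.LegendreCoeffs
open Summit.NavierStokesRegularity.TurbBounds.LadderTail (w)
open Summit.NavierStokesRegularity.TurbBounds.Certs.S50

/-! ## 1. The row's profile derivative and its three scalar facts -/

/-- The row's Legendre data `φ̂_p` as real numbers (`Certs.S50.Scalars.phi`, `P = 4`; `0` beyond). -/
def phiS50 (p : ℕ) : ℝ := ((Scalars.phi.getD p 0 : ℚ) : ℝ)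

/-- The profile derivative `φ′ = dφ/dζ = Σ_{p ≤ 4} φ̂_p P_p(ζ)` of the certified background field (FW16 (4.4)). -/
def profileS50 : ℝ[X] := ∑ p ∈ range (4 + 1), C (phiS50 p) * legendre p

/-- Legendre coefficients of the profile derivative: `ĉ_n(φ′) = φ̂_n` (`n ≤ 4`), `0` beyond. -/
theorem legCoeff_profileS50 (n : ℕ) : legCoeff profileS50 n = if n ≤ 4 then phiS50 n else 0 :=
  legCoeff_expansion 4 phiS50 n

/-- `deg φ′ ≤ 4`. -/
theorem natDegree_profileS50_le : profileS50.natDegree ≤ 4 := by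
  unfold profileS50
  refine natDegree_sum_le_of_forall_le _ _ fun p hp => ?_
  have hp4 : p ≤ 4 := by simp at hp; omega
  exact (natDegree_C_mul_le _ _).trans ((natDegree_legendre p).le.trans hp4)

/-- **Stress boundary condition** `φ′(1) = Σ φ̂_p = Gr/2` (FW16 (4.5); `Scalars.sum_phi`). -/
theorem profileS50_eval_one : profileS50.eval 1 = (Scalars.Gr : ℝ) / 2 := by
  unfold profileS50
  rw [eval_finsetSum]
  simp only [eval_mul, eval_C, eval_one_legendre, mul_one, Finset.sum_range_succ, Finset.sum_range_zero, phiS50]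
  norm_num [Scalars.phi, Scalars.Gr]

/-- **Sup bound** `|φ′(x)| ≤ ‖φ̂‖₁ = T` on `[−1, 1]` (FW16 (4.6); `|P_p| ≤ 1`, `Scalars.l1_phi`). -/
theorem profileS50_abs_le : ∀ x ∈ Icc (-1 : ℝ) 1, |profileS50.eval x| ≤ (Scalars.T : ℝ) := by
  intro x hx
  have hx1 : |x| ≤ 1 := abs_le.mpr ⟨hx.1, hx.2⟩
  unfold profileS50
  rw [eval_finsetSum]
  calc |∑ p ∈ range (4 + 1), (C (phiS50 p) * legendre p).eval x|
      ≤ ∑ p ∈ range (4 + 1), |(C (phiS50 p) * legendre p).eval x| := Finset.abs_sum_le_sum_abs _ _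
    _ ≤ ∑ p ∈ range (4 + 1), |phiS50 p| := by
        refine Finset.sum_le_sum fun p _ => ?_
        rw [eval_mul, eval_C, abs_mul]
        calc |phiS50 p| * |(legendre p).eval x| ≤ |phiS50 p| * 1 :=
              mul_le_mul_of_nonneg_left (abs_eval_legendre_le_one p hx1) (abs_nonneg _)
          _ = |phiS50 p| := mul_one _
    _ = (Scalars.T : ℝ) := by
        simp only [Finset.sum_range_succ, Finset.sum_range_zero, phiS50]
        norm_num [Scalars.phi, Scalars.T]

/-- `∫_{−1}^{1} φ′ = 2φ̂₀` (= `φ(1)`, FW16 App. A). -/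
theorem integral_profileS50 : (∫ x in (-1 : ℝ)..1, profileS50.eval x) = 2 * phiS50 0 := by
  have h := legCoeff_profileS50 0
  rw [if_pos (by norm_num)] at h
  unfold legCoeff at h
  have e : (∫ x in (-1 : ℝ)..1, profileS50.eval x * (legendre 0).eval x) = ∫ x in (-1 : ℝ)..1, profileS50.eval x :=
    intervalIntegral.integral_congr fun x _ => by simp [legendre_zero]
  rw [e] at h
  norm_num at h
  linarith

/-- `∫_{−1}^{1} φ′² = Σ_{p ≤ 4} (2/(2p+1)) φ̂_p²` (finite Parseval, FW16 (4.7)). -/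
theorem integral_profileS50_sq : (∫ x in (-1 : ℝ)..1, profileS50.eval x ^ 2) = ∑ k ∈ range (4 + 1), w k * phiS50 k ^ 2 := by
  rw [integral_sq_eq_sum profileS50 natDegree_profileS50_le]
  refine Finset.sum_congr rfl fun k hk => ?_
  rw [legCoeff_profileS50, if_pos (by simp at hk; omega)]

/-- **The bound value is the certified `U`**: `2∫φ′ − (2/Gr)∫φ′² = 4φ̂₀ − (2/Gr)Σ 2φ̂_p²/(2p+1) = Scalars.U` (FW16 (4.10); `Scalars.U_eq`). -/
theorem boundValue_profileS50 : boundValue (Scalars.Gr : ℝ) (fun x => profileS50.eval x) = (Scalars.U : ℝ) := by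
  unfold boundValue
  rw [integral_profileS50, integral_profileS50_sq]
  simp only [Finset.sum_range_succ, Finset.sum_range_zero, phiS50, w]
  norm_num [Scalars.phi, Scalars.Gr, Scalars.U]

/-! ## 2. The second named hypothesis: polynomial positivity of the certified modes -/

/-- **Named hypothesis `PolyPositivityS50`** (to be DISCHARGED by the staged algebraic chain; v2 items V2-BRIDGE/V2-TAIL): for each certified mode
`m = 1, …, m_cert = 2` of the row and every pair of real polynomials `(U, V)` with `U(±1) = V(±1) = 0`, `U′(−1) = V′(−1) = 0`, the relaxed
per-mode form of rbsdp SPEC 2.2 with the cell's constants `A_m, C_m, D_m` (`ShearForm.Acell/Ccell/Dcell` at `Γx = Scalars.Gx`) and the row's profile derivative `φ′` is `≥ 0`: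
`A_m‖W″‖² + 8‖W′‖² + C_m‖W‖² − D_m ∫φ′·Im(W′W̄) ≥ 0`, `W = U + iV`. (On polynomial pairs this number IS, by `ShearBridgeNorms.norms_split` and
the cross-term identity, the right-hand side of `Certs.S50.ModeForm.M<m>.modeForm_nonneg` at the Legendre coefficients of `W″`.) -/
def PolyPositivityS50 : Prop :=
  ∀ m : ℕ, 1 ≤ m → m ≤ Scalars.mCert → ∀ Up Vp : ℝ[X],
    Up.eval (-1) = 0 → (derivative Up).eval (-1) = 0 → Up.eval 1 = 0 →
    Vp.eval (-1) = 0 → (derivative Vp).eval (-1) = 0 → Vp.eval 1 = 0 →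
    0 ≤ shearForm (Acell (Scalars.Gx : ℝ) m) (Ccell (Scalars.Gx : ℝ) m) (Dcell (Scalars.Gx : ℝ) m)
      (fun x => profileS50.eval x) (fun x => Up.eval x) (fun x => Vp.eval x)

/-- **From polynomial positivity of the two certified modes to FW16's spectral constraint for EVERY mode** on the admissible `C²` class:
density (`ShearDensity`), the rational relaxation with the cell's constants (`fw16Form_nonneg_of_shearForm_cell`), and the cover by the landed
cutoff line `Certs.S50.Scalars.cutoff` (modes `m ≥ 3` are free, FW16 (2.17)–(2.18)). -/
theorem fw16Positivity_of_polyPositivity (h : PolyPositivityS50) : FW16Positivity (Scalars.Gx : ℝ) (fun x => profileS50.eval x) := by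
  have hGx : (0 : ℝ) < (Scalars.Gx : ℝ) := by norm_num [Scalars.Gx]
  refine fw16Positivity_of_cover hGx profileS50_abs_le Scalars.cutoff fun m hm hle U V hUV => ?_
  have hpoly := shearForm_nonneg_of_poly (A := Acell (Scalars.Gx : ℝ) m) (C := Ccell (Scalars.Gx : ℝ) m) (D := Dcell (Scalars.Gx : ℝ) m)
    profileS50.continuous (fun Up Vp h0 h1 h2 h3 h4 h5 => h m hm hle Up Vp h0 h1 h2 h3 h4 h5) hUV
  exact fw16Form_nonneg_of_shearForm_mode hGx hm profileS50.continuous hUV.hU hUV.hV hpoly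

/-! ## 3. The row theorem from the two named hypotheses -/

/-- **Row R2-50, mean surface velocity.** For every `ū` obeying the cited reduction `FW16Reduction Γx Gr ū` at `(Γx, Gr) = (2, 50)` and given
`PolyPositivityS50`: `U = Scalars.U ≤ ū` (`U ≥ 49.999999998`, `Scalars.U_decimal`). -/
theorem surfaceVelocity_bound (ubar : ℝ) (hRed : FW16Reduction (Scalars.Gx : ℝ) (Scalars.Gr : ℝ) ubar) (hPoly : PolyPositivityS50) :
    (Scalars.U : ℝ) ≤ ubar := by
  rw [← boundValue_profileS50]
  exact hRed profileS50 profileS50_eval_one (fw16Positivity_of_polyPositivity hPoly)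

/-- **Row R2-50, dissipation coefficient.** Under the same two hypotheses `C_ε = Gr/ū² ≤ Scalars.Ceps` (`= Gr/U²`, `Scalars.Ceps_eq`). -/
theorem ceps_bound (ubar : ℝ) (hRed : FW16Reduction (Scalars.Gx : ℝ) (Scalars.Gr : ℝ) ubar) (hPoly : PolyPositivityS50) :
    (Scalars.Gr : ℝ) / ubar ^ 2 ≤ (Scalars.Ceps : ℝ) := by
  have hU : (0 : ℝ) < (Scalars.U : ℝ) := by exact_mod_cast Scalars.U_pos
  have hGr : (0 : ℝ) ≤ (Scalars.Gr : ℝ) := by norm_num [Scalars.Gr]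
  have hC : (Scalars.Ceps : ℝ) = (Scalars.Gr : ℝ) / (Scalars.U : ℝ) ^ 2 := by
    have h := Scalars.Ceps_eq
    rw [h]; push_cast; ring
  rw [hC]
  exact ceps_le_of_lower_bound hGr hU (surfaceVelocity_bound ubar hRed hPoly)

/-- The outward decimal of CERTIFIED.md row R2-50: `C_ε ≤ 0.020000000002`. -/
theorem ceps_bound_decimal (ubar : ℝ) (hRed : FW16Reduction (Scalars.Gx : ℝ) (Scalars.Gr : ℝ) ubar) (hPoly : PolyPositivityS50) :
    (Scalars.Gr : ℝ) / ubar ^ 2 ≤ (10000000001 : ℝ) / 500000000000 := by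
  have h := ceps_bound ubar hRed hPoly
  have hd : ((Scalars.Ceps : ℚ) : ℝ) ≤ (((10000000001 : ℚ) / 500000000000 : ℚ) : ℝ) := by exact_mod_cast Scalars.Ceps_decimal
  push_cast at hd
  linarith

/-! ## 4. Vacuity guards -/

/-- The first hypothesis is satisfiable as typed at this row's parameters (laminar value `ū = Gr = 50`). -/
theorem fw16Reduction_laminar_row : FW16Reduction (2 : ℝ) 50 50 :=
  fw16Reduction_laminar 2 (by norm_num)

/-- … and, given `PolyPositivityS50`, NOT provable for every `ū`: `ū = 0` violates it (`U > 0`). -/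
theorem fw16Reduction_nontrivial (hPoly : PolyPositivityS50) : ¬ FW16Reduction (Scalars.Gx : ℝ) (Scalars.Gr : ℝ) 0 := by
  intro hRed
  have h := surfaceVelocity_bound 0 hRed hPoly
  have hU : (0 : ℝ) < (Scalars.U : ℝ) := by exact_mod_cast Scalars.U_pos
  linarith

end Summit.NavierStokesRegularity.TurbBounds.Results.S50

end
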